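import Summits.QuantumFields.BalabanUV.Beta.EriceFlowEnclosureB12AsPrintedHistoryContagionShiftFlowZeroTangentSecondFlow
import Summits.QuantumFields.BalabanUV.Beta.EriceFlowEnclosureB12AsPrintedHistoryContagionShiftFlowZeroTangentProduct

/-!
# Beta / EriceFlowEnclosureB12AsPrintedHistoryContagionShiftFlowZeroTangentSecondDeriv — ASYMPTOTIC FREEDOM IS CONTAGIOUS, part 81: C² MEMORY ⟹ A TWICE DIFFERENTIABLE
# RENORMALIZATION GROUP.  FOR THE FLOW (part 14's package at e′) under the C² SHAPE of part 78 (`hG`, `hGB`, `hH`, `hHB` — explicit binders): (§146) a TANGENT FIELD (part 76)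
# is DIFFERENTIABLE IN ITS PIN AT EVERY SCALE, **`HasDerivAt (x ↦ W_k(x)) (V_k·(−2∕e³)) e`** at every interior pin, V the second tangent flow of part 78 (part 80's uniform
# convergence of the chart quotients, times the chart slope `−2∕e³` — part 69's pattern one order up); (§147) its ultraviolet limit `W_∞(x)` is differentiable with
# **`HasDerivAt W_∞ (V_∞·(−2∕e³)) e`**, `V_∞ = lim_k V_k` (part 78) — NO uniform-limit-of-derivatives theorem: part 80's closeness holds at ALL scales at once, so it passes to
# the limit k → ∞ inside (part 70's `lim_quotient_sub_tangentLimit_abs_le`); (§148) hence EVERY DYNAMICAL ABEL FUNCTION Λ (part 44's interface) IS TWICE DIFFERENTIABLE AT EVERY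
# COUPLING: `Λ′(x) = −2W_∞(x)∕x³` near e (part 70) gives **`HasDerivAt Λ′ (4V_∞∕e⁶ + 6W_∞(e)∕e⁴) e`**, i.e. **`Λ″(e) = −(3∕e)·Λ′(e) + (4∕e⁶)·V_∞(e)`** — the one-loop part
# `−(3∕e)Λ′` (for `Λ = 1∕e²`: `Λ″ = 6∕e⁴`) plus the memory correction carried by the second tangent flow; `Λ′` is differentiable on the whole open box ]0, e′[
# (`differentiableOn_deriv_dynAbel`, all witnesses produced from parts 76 and 78).  Continuity of `Λ″` (Λ ∈ C²) wants the continuity of `V_∞` in the pin — the C² analogue of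
# part 71 — and is NOT claimed here
# (β-flow team, prover 1, unit `b2b-balaban-beta-bflow-p1`, gen 43; ROW AP-I·Uc × NODE U2)

HONEST FRAMING (page 1 of everything the β sub-cell writes): discharging `BetaPertH` makes Bałaban's UV stability UNCONDITIONAL — a
real constructive-QFT result; it is NOT the continuum limit and NOT the Clay problem.  HONEST DEPENDENCY (cell reorg 2026-08-19,
verbatim): «continuum YM on T⁴ ⇐ BetaPertH ∧ nine spine estimates (0/9 proved); BetaPertH ⇐ (D1) ∧ (D4) ∧ CAP+tail; G-an2-4 gates
asym, D1 and NE2/3/4.»  THIS MODULE DISCHARGES NOTHING: [folklore] real analysis (the slope characterisation `hasDerivAt_iff_tendsto_slope`, the product rule, the chain rule for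
`x ↦ −2∕x³`, `HasDerivAt.congr_of_eventuallyEq`) over node U2's HYPOTHESIS SHAPES `T4BetaStationary.{SeqBox, MemoryProfile}`, `T4BetaFlowWellPosed.{MemFlow, solution}` and
parts 68–70, 76, 78, 80 of this series BY NAME (NOT PRINTED for [I] = T. Bałaban, Commun. Math. Phys. **109** (1987) [Balaban1987RG1]: p. 298 says only that β_j depends on the
preceding couplings; (0.20) p. 256; Theorem 2 (0.31) p. 259 STATED WITHOUT PROOF; no derivative of the coupling flow in its datum is printed in [I]; Erice 1985 (3.61)–(3.62)
p. 250 differentiate the CONTINUUM coupling in the scale).  The C² shape, the tangent field, the second tangent flow and the dynamical Abel function are explicit binders (all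
inhabited: parts 13, 44, 76, 78).  Nothing of Bałaban's β is asserted.

WHAT THIS FILE PROVES (0 sorry, 0 def): §146 `secondQuotient_tendsto`, `chart_hasDerivAt`, **`hasDerivAt_tangentField`**; §147 `tangentLimitField_slope_tendsto`,
**`hasDerivAt_tangentLimitField`**; §148 `chartFactor_hasDerivAt`, `deriv_dynAbel_eq_field`, **`hasDerivAt_deriv_dynAbel`**, **`deriv_deriv_dynAbel_eq`**,
**`differentiableOn_deriv_dynAbel`**.  NOT CLAIMED: continuity of Λ″ (Λ ∈ C²); anything about Bałaban's β; `BetaPertH`; the continuum limit of the measures; Clay.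
-/

namespace Summit.QuantumFields.BalabanUV.Beta.EriceFlowEnclosureB12AsPrintedHistoryContagionShiftFlowZeroTangentSecondDeriv

open Finset Filter Topology Set
open Literature.MathematicalPhysics.QuantumFieldTheory.Balaban1983to89
open Literature.MathematicalPhysics.QuantumFieldTheory.Balaban1983to89.T4CouplingMatching (sprof)
open Literature.MathematicalPhysics.QuantumFieldTheory.Balaban1983to89.T4BetaStationary (SeqBox MemoryProfile)
open Literature.MathematicalPhysics.QuantumFieldTheory.Balaban1983to89.T4BetaFlowWellPosed (MemFlow solution)
open Summit.QuantumFields.BalabanUV.Beta.EriceFlowEnclosureB12AsPrintedHistoryContagionShiftFlowZeroTangentDeriv (invSq_sub_ne_zero)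
open Summit.QuantumFields.BalabanUV.Beta.EriceFlowEnclosureB12AsPrintedHistoryContagionShiftFlowZeroTangentLambda (tangentLimit_exists deriv_dynAbel_eq
  lim_quotient_sub_tangentLimit_abs_le)
open Summit.QuantumFields.BalabanUV.Beta.EriceFlowEnclosureB12AsPrintedHistoryContagionShiftFlowZeroTangentProduct (tangentField_exists)
open Summit.QuantumFields.BalabanUV.Beta.EriceFlowEnclosureB12AsPrintedHistoryContagionShiftFlowZeroTangentSecond (derivedSource_limit_exists secondTangent_exists
  secondTangentLimit_exists)
open Summit.QuantumFields.BalabanUV.Beta.EriceFlowEnclosureB12AsPrintedHistoryContagionShiftFlowZeroTangentSecondFlow (secondQuotient_tendsto_uniform)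

noncomputable section

/-! ## §146 A tangent field is differentiable in its pin at every scale -/

/-- **THE CHART QUOTIENTS OF A TANGENT FIELD CONVERGE TO THE SECOND TANGENT FLOW** (part 80 read for a field): for a tangent field Wf on ]0, e′], an interior pin e, and V a bounded
solution of part 78's derived equation at e (for `W = Wf e`): **`(Wf x k − Wf e k)∕(1∕x² − 1∕e²) → V_k` as x → e, x ≠ e**, for every k.
[cite: Balaban1987RG1, Thm 2 (0.31) p.259 with (0.20) p.256 and p.298] -/
theorem secondQuotient_tendsto {B : (ℕ → ℝ) → ℝ} {G : (ℕ → ℝ) → ℕ → ℝ} {H : (ℕ → ℝ) → ℕ → ℕ → ℝ} {Cm CH θ γ bs ta gs e' MV : ℝ} {t V : ℕ → ℝ} {Wf : ℝ → ℕ → ℝ}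
    (hB : MemoryProfile Cm θ γ B) (hCm : 0 ≤ Cm) (hθ0 : 0 ≤ θ) (hθ1 : θ < 1) (hbs : 0 < bs) (hta : 0 < ta)
    (hts : SeqBox γ t) (htf : MemFlow B gs t) (hprof : ∀ m : ℕ, 1 / ta ^ 2 + bs * (m : ℝ) ≤ 1 / (t m) ^ 2)
    (hG : ∀ u : ℕ → ℝ, SeqBox γ u → ∀ j, |G u j| ≤ Cm * θ ^ j)
    (hGB : ∀ ε > 0, ∃ ρ > 0, ∀ u u' : ℕ → ℝ, SeqBox γ u → SeqBox γ u' → (∀ j, |u' j - u j| ≤ ρ) →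
      |B u' - B u - ∑' j, G u j * (u' j - u j)| ≤ ε * ∑' j, θ ^ j * |u' j - u j|) (hCH : 0 ≤ CH)
    (hH : ∀ u : ℕ → ℝ, SeqBox γ u → ∀ j i, |H u j i| ≤ CH * θ ^ j * θ ^ i)
    (hHB : ∀ ε > 0, ∃ ρ > 0, ∀ u u' : ℕ → ℝ, SeqBox γ u → SeqBox γ u' → (∀ j, |u' j - u j| ≤ ρ) →
      ∀ j, |G u' j - G u j - ∑' i, H u j i * (u' i - u i)| ≤ ε * θ ^ j * ∑' i, θ ^ i * |u' i - u i|)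
    (h2e' : 2 * e' ≤ γ) (hs1 : 4 * Cm * e' ≤ bs * (1 - θ))
    (hs2 : e' ^ 2 * (1 / gs ^ 2 + Cm * γ / (1 - θ) ^ 2 + (2 * Cm / ((1 - θ) * bs)) ^ 2) ≤ 3 / 4)
    (hs4 : 64 * Cm * e' ^ 3 ≤ (1 - θ) ^ 2) (hs5 : Cm * (8 * e' ^ 3 + 16 * e' / bs) ≤ (1 - θ) / 4)
    (hWf : ∀ x ∈ Ioc (0 : ℝ) e',
      (∀ k, Wf x k = 1 - ∑ p ∈ range k, ∑' j, G (fun i => solution B x (p + 1 + i)) j * ((solution B x (p + 1 + j)) ^ 3 / 2) * Wf x (p + 1 + j)) ∧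
      ∀ k, |Wf x k| ≤ 2)
    {e : ℝ} (he : e ∈ Ioo (0 : ℝ) e')
    (hV : ∀ k, V k = (-∑ p ∈ range k, ∑' j,
        ((-∑' i, H (fun l => solution B e (p + 1 + l)) j i * ((solution B e (p + 1 + i)) ^ 3 / 2 * Wf e (p + 1 + i))) * ((solution B e (p + 1 + j)) ^ 3 / 2)
          + G (fun i => solution B e (p + 1 + i)) j * (-(3 / 4 * (solution B e (p + 1 + j)) ^ 5 * Wf e (p + 1 + j)))) * Wf e (p + 1 + j))
      - ∑ p ∈ range k, ∑' j, G (fun i => solution B e (p + 1 + i)) j * ((solution B e (p + 1 + j)) ^ 3 / 2) * V (p + 1 + j))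
    (hVM : ∀ k, |V k| ≤ MV) (k : ℕ) :
    Tendsto (fun x => (Wf x k - Wf e k) / (1 / x ^ 2 - 1 / e ^ 2)) (𝓝[≠] e) (𝓝 (V k)) := by
  have hec : e ∈ Ioc (0 : ℝ) e' := ⟨he.1, he.2.le⟩
  rw [Metric.tendsto_nhds]
  intro ε hε
  have h := secondQuotient_tendsto_uniform hB hCm hθ0 hθ1 hbs hta hts htf hprof hG hGB hCH hH hHB h2e' hs1 hs2 hs4 hs5 he (hWf e hec).1 (hWf e hec).2
    hV hVM (half_pos hε)
  filter_upwards [h] with x hx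
  obtain ⟨hx, hall⟩ := hx
  have := hall (Wf x) (hWf x hx).1 (hWf x hx).2 k
  rw [Real.dist_eq]
  linarith

/-- The chart `x ↦ 1∕x²` has derivative `−2∕e³` at `e ≠ 0`. [folklore] -/
theorem chart_hasDerivAt {e : ℝ} (he : e ≠ 0) : HasDerivAt (fun x : ℝ => 1 / x ^ 2) (-2 / e ^ 3) e := by
  have h1 : HasDerivAt (fun x : ℝ => x ^ 2) (2 * e) e := by simpa using hasDerivAt_pow 2 e
  have h2 := h1.fun_inv (pow_ne_zero 2 he)
  have e3 : -(2 * e) / (e ^ 2) ^ 2 = -2 / e ^ 3 := by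
    rw [div_eq_div_iff (by positivity) (by positivity)]; ring
  rw [← e3]
  refine h2.congr_of_eventuallyEq (Eventually.of_forall fun x => ?_)
  simp [one_div]

/-- **A TANGENT FIELD IS DIFFERENTIABLE IN ITS PIN AT EVERY SCALE.**  Part 14's package at e′; the C² shape (`hG`, `hGB`, `hH`, `hHB`); a tangent field Wf on ]0, e′] (part 76); an
INTERIOR pin `e ∈ ]0, e′[`; V a bounded solution of part 78's derived equation at e for `W = Wf e`.  THEN at every scale k: **`HasDerivAt (x ↦ Wf x k) (V_k·(−2∕e³)) e`** — the
slope is the chart quotient (→ V_k by part 80, uniformly in k) times the chart slope `(1∕x² − 1∕e²)∕(x − e) → −2∕e³`.  The second tangent flow IS the pin-derivative of the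
tangent flow, read through the chart. [cite: Balaban1987RG1, Thm 2 (0.31) p.259 with (0.20) p.256 and p.298] -/
theorem hasDerivAt_tangentField {B : (ℕ → ℝ) → ℝ} {G : (ℕ → ℝ) → ℕ → ℝ} {H : (ℕ → ℝ) → ℕ → ℕ → ℝ} {Cm CH θ γ bs ta gs e' MV : ℝ} {t V : ℕ → ℝ} {Wf : ℝ → ℕ → ℝ}
    (hB : MemoryProfile Cm θ γ B) (hCm : 0 ≤ Cm) (hθ0 : 0 ≤ θ) (hθ1 : θ < 1) (hbs : 0 < bs) (hta : 0 < ta)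
    (hts : SeqBox γ t) (htf : MemFlow B gs t) (hprof : ∀ m : ℕ, 1 / ta ^ 2 + bs * (m : ℝ) ≤ 1 / (t m) ^ 2)
    (hG : ∀ u : ℕ → ℝ, SeqBox γ u → ∀ j, |G u j| ≤ Cm * θ ^ j)
    (hGB : ∀ ε > 0, ∃ ρ > 0, ∀ u u' : ℕ → ℝ, SeqBox γ u → SeqBox γ u' → (∀ j, |u' j - u j| ≤ ρ) →
      |B u' - B u - ∑' j, G u j * (u' j - u j)| ≤ ε * ∑' j, θ ^ j * |u' j - u j|) (hCH : 0 ≤ CH)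
    (hH : ∀ u : ℕ → ℝ, SeqBox γ u → ∀ j i, |H u j i| ≤ CH * θ ^ j * θ ^ i)
    (hHB : ∀ ε > 0, ∃ ρ > 0, ∀ u u' : ℕ → ℝ, SeqBox γ u → SeqBox γ u' → (∀ j, |u' j - u j| ≤ ρ) →
      ∀ j, |G u' j - G u j - ∑' i, H u j i * (u' i - u i)| ≤ ε * θ ^ j * ∑' i, θ ^ i * |u' i - u i|)
    (h2e' : 2 * e' ≤ γ) (hs1 : 4 * Cm * e' ≤ bs * (1 - θ))
    (hs2 : e' ^ 2 * (1 / gs ^ 2 + Cm * γ / (1 - θ) ^ 2 + (2 * Cm / ((1 - θ) * bs)) ^ 2) ≤ 3 / 4)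
    (hs4 : 64 * Cm * e' ^ 3 ≤ (1 - θ) ^ 2) (hs5 : Cm * (8 * e' ^ 3 + 16 * e' / bs) ≤ (1 - θ) / 4)
    (hWf : ∀ x ∈ Ioc (0 : ℝ) e',
      (∀ k, Wf x k = 1 - ∑ p ∈ range k, ∑' j, G (fun i => solution B x (p + 1 + i)) j * ((solution B x (p + 1 + j)) ^ 3 / 2) * Wf x (p + 1 + j)) ∧
      ∀ k, |Wf x k| ≤ 2)
    {e : ℝ} (he : e ∈ Ioo (0 : ℝ) e')
    (hV : ∀ k, V k = (-∑ p ∈ range k, ∑' j,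
        ((-∑' i, H (fun l => solution B e (p + 1 + l)) j i * ((solution B e (p + 1 + i)) ^ 3 / 2 * Wf e (p + 1 + i))) * ((solution B e (p + 1 + j)) ^ 3 / 2)
          + G (fun i => solution B e (p + 1 + i)) j * (-(3 / 4 * (solution B e (p + 1 + j)) ^ 5 * Wf e (p + 1 + j)))) * Wf e (p + 1 + j))
      - ∑ p ∈ range k, ∑' j, G (fun i => solution B e (p + 1 + i)) j * ((solution B e (p + 1 + j)) ^ 3 / 2) * V (p + 1 + j))
    (hVM : ∀ k, |V k| ≤ MV) (k : ℕ) :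
    HasDerivAt (fun x : ℝ => Wf x k) (V k * (-2 / e ^ 3)) e := by
  rw [hasDerivAt_iff_tendsto_slope, slope_fun_def_field]
  have hD := secondQuotient_tendsto hB hCm hθ0 hθ1 hbs hta hts htf hprof hG hGB hCH hH hHB h2e' hs1 hs2 hs4 hs5 hWf he hV hVM k
  have hslope := hasDerivAt_iff_tendsto_slope.1 (chart_hasDerivAt he.1.ne')
  rw [slope_fun_def_field] at hslope
  have hprod := hD.mul hslope
  refine hprod.congr' ?_
  have hmem : ∀ᶠ x in 𝓝 e, x ∈ Ioo (0 : ℝ) e' := Ioo_mem_nhds he.1 he.2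
  filter_upwards [self_mem_nhdsWithin, eventually_nhdsWithin_of_eventually_nhds hmem] with x hne hx
  have hδne : 1 / x ^ 2 - 1 / e ^ 2 ≠ 0 := invSq_sub_ne_zero he.1 hx.1 hne
  rw [div_mul_div_comm, mul_comm (1 / x ^ 2 - 1 / e ^ 2), ← div_mul_div_comm, div_self hδne, mul_one]

/-! ## §147 The ultraviolet limit of the tangent field is differentiable in the pin -/

/-- **THE CHART QUOTIENTS OF `W_∞` CONVERGE TO `V_∞`**: with `Winff x = lim_k Wf x k` on ]0, e′] (part 70) and `V_∞ = lim_k V_k` (part 78):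
**`(W_∞(x) − W_∞(e))∕(1∕x² − 1∕e²) → V_∞` as x → e, x ≠ e** — part 80's closeness holds at all scales at once, so it survives k → ∞ (part 70's
`lim_quotient_sub_tangentLimit_abs_le`); no uniform convergence of derivatives is invoked. [cite: Balaban1987RG1, Thm 2 (0.31) p.259 with (0.20) p.256 and p.298] -/
theorem tangentLimitField_slope_tendsto {B : (ℕ → ℝ) → ℝ} {G : (ℕ → ℝ) → ℕ → ℝ} {H : (ℕ → ℝ) → ℕ → ℕ → ℝ} {Cm CH θ γ bs ta gs e' MV Vinf : ℝ} {t V : ℕ → ℝ}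
    {Wf : ℝ → ℕ → ℝ} {Winff : ℝ → ℝ}
    (hB : MemoryProfile Cm θ γ B) (hCm : 0 ≤ Cm) (hθ0 : 0 ≤ θ) (hθ1 : θ < 1) (hbs : 0 < bs) (hta : 0 < ta)
    (hts : SeqBox γ t) (htf : MemFlow B gs t) (hprof : ∀ m : ℕ, 1 / ta ^ 2 + bs * (m : ℝ) ≤ 1 / (t m) ^ 2)
    (hG : ∀ u : ℕ → ℝ, SeqBox γ u → ∀ j, |G u j| ≤ Cm * θ ^ j)
    (hGB : ∀ ε > 0, ∃ ρ > 0, ∀ u u' : ℕ → ℝ, SeqBox γ u → SeqBox γ u' → (∀ j, |u' j - u j| ≤ ρ) →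
      |B u' - B u - ∑' j, G u j * (u' j - u j)| ≤ ε * ∑' j, θ ^ j * |u' j - u j|) (hCH : 0 ≤ CH)
    (hH : ∀ u : ℕ → ℝ, SeqBox γ u → ∀ j i, |H u j i| ≤ CH * θ ^ j * θ ^ i)
    (hHB : ∀ ε > 0, ∃ ρ > 0, ∀ u u' : ℕ → ℝ, SeqBox γ u → SeqBox γ u' → (∀ j, |u' j - u j| ≤ ρ) →
      ∀ j, |G u' j - G u j - ∑' i, H u j i * (u' i - u i)| ≤ ε * θ ^ j * ∑' i, θ ^ i * |u' i - u i|)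
    (h2e' : 2 * e' ≤ γ) (hs1 : 4 * Cm * e' ≤ bs * (1 - θ))
    (hs2 : e' ^ 2 * (1 / gs ^ 2 + Cm * γ / (1 - θ) ^ 2 + (2 * Cm / ((1 - θ) * bs)) ^ 2) ≤ 3 / 4)
    (hs4 : 64 * Cm * e' ^ 3 ≤ (1 - θ) ^ 2) (hs5 : Cm * (8 * e' ^ 3 + 16 * e' / bs) ≤ (1 - θ) / 4)
    (hWf : ∀ x ∈ Ioc (0 : ℝ) e',
      (∀ k, Wf x k = 1 - ∑ p ∈ range k, ∑' j, G (fun i => solution B x (p + 1 + i)) j * ((solution B x (p + 1 + j)) ^ 3 / 2) * Wf x (p + 1 + j)) ∧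
      ∀ k, |Wf x k| ≤ 2)
    (hWinff : ∀ x ∈ Ioc (0 : ℝ) e', Tendsto (Wf x) atTop (𝓝 (Winff x)))
    {e : ℝ} (he : e ∈ Ioo (0 : ℝ) e')
    (hV : ∀ k, V k = (-∑ p ∈ range k, ∑' j,
        ((-∑' i, H (fun l => solution B e (p + 1 + l)) j i * ((solution B e (p + 1 + i)) ^ 3 / 2 * Wf e (p + 1 + i))) * ((solution B e (p + 1 + j)) ^ 3 / 2)
          + G (fun i => solution B e (p + 1 + i)) j * (-(3 / 4 * (solution B e (p + 1 + j)) ^ 5 * Wf e (p + 1 + j)))) * Wf e (p + 1 + j))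
      - ∑ p ∈ range k, ∑' j, G (fun i => solution B e (p + 1 + i)) j * ((solution B e (p + 1 + j)) ^ 3 / 2) * V (p + 1 + j))
    (hVM : ∀ k, |V k| ≤ MV) (hVinf : Tendsto V atTop (𝓝 Vinf)) :
    Tendsto (fun x => (Winff x - Winff e) / (1 / x ^ 2 - 1 / e ^ 2)) (𝓝[≠] e) (𝓝 Vinf) := by
  have hec : e ∈ Ioc (0 : ℝ) e' := ⟨he.1, he.2.le⟩
  rw [Metric.tendsto_nhds]
  intro ε hε
  have h := secondQuotient_tendsto_uniform hB hCm hθ0 hθ1 hbs hta hts htf hprof hG hGB hCH hH hHB h2e' hs1 hs2 hs4 hs5 he (hWf e hec).1 (hWf e hec).2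
    hV hVM (half_pos hε)
  filter_upwards [h] with x hx
  obtain ⟨hx, hall⟩ := hx
  have hq : Tendsto (fun k => (Wf x k - Wf e k) / (1 / x ^ 2 - 1 / e ^ 2)) atTop (𝓝 ((Winff x - Winff e) / (1 / x ^ 2 - 1 / e ^ 2))) :=
    ((hWinff x hx).sub (hWinff e hec)).div_const _
  have := lim_quotient_sub_tangentLimit_abs_le hq hVinf (hall (Wf x) (hWf x hx).1 (hWf x hx).2)
  rw [Real.dist_eq]
  linarith

/-- **THE ULTRAVIOLET LIMIT OF THE TANGENT FIELD IS DIFFERENTIABLE IN THE PIN**: **`HasDerivAt W_∞ (V_∞·(−2∕e³)) e`** at every interior pin (the chart quotient of `W_∞` → `V_∞`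
by `tangentLimitField_slope_tendsto`, times the chart slope). [cite: Balaban1987RG1, Thm 2 (0.31) p.259 with (0.20) p.256 and p.298] -/
theorem hasDerivAt_tangentLimitField {B : (ℕ → ℝ) → ℝ} {G : (ℕ → ℝ) → ℕ → ℝ} {H : (ℕ → ℝ) → ℕ → ℕ → ℝ} {Cm CH θ γ bs ta gs e' MV Vinf : ℝ} {t V : ℕ → ℝ}
    {Wf : ℝ → ℕ → ℝ} {Winff : ℝ → ℝ}
    (hB : MemoryProfile Cm θ γ B) (hCm : 0 ≤ Cm) (hθ0 : 0 ≤ θ) (hθ1 : θ < 1) (hbs : 0 < bs) (hta : 0 < ta)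
    (hts : SeqBox γ t) (htf : MemFlow B gs t) (hprof : ∀ m : ℕ, 1 / ta ^ 2 + bs * (m : ℝ) ≤ 1 / (t m) ^ 2)
    (hG : ∀ u : ℕ → ℝ, SeqBox γ u → ∀ j, |G u j| ≤ Cm * θ ^ j)
    (hGB : ∀ ε > 0, ∃ ρ > 0, ∀ u u' : ℕ → ℝ, SeqBox γ u → SeqBox γ u' → (∀ j, |u' j - u j| ≤ ρ) →
      |B u' - B u - ∑' j, G u j * (u' j - u j)| ≤ ε * ∑' j, θ ^ j * |u' j - u j|) (hCH : 0 ≤ CH)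
    (hH : ∀ u : ℕ → ℝ, SeqBox γ u → ∀ j i, |H u j i| ≤ CH * θ ^ j * θ ^ i)
    (hHB : ∀ ε > 0, ∃ ρ > 0, ∀ u u' : ℕ → ℝ, SeqBox γ u → SeqBox γ u' → (∀ j, |u' j - u j| ≤ ρ) →
      ∀ j, |G u' j - G u j - ∑' i, H u j i * (u' i - u i)| ≤ ε * θ ^ j * ∑' i, θ ^ i * |u' i - u i|)
    (h2e' : 2 * e' ≤ γ) (hs1 : 4 * Cm * e' ≤ bs * (1 - θ))
    (hs2 : e' ^ 2 * (1 / gs ^ 2 + Cm * γ / (1 - θ) ^ 2 + (2 * Cm / ((1 - θ) * bs)) ^ 2) ≤ 3 / 4)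
    (hs4 : 64 * Cm * e' ^ 3 ≤ (1 - θ) ^ 2) (hs5 : Cm * (8 * e' ^ 3 + 16 * e' / bs) ≤ (1 - θ) / 4)
    (hWf : ∀ x ∈ Ioc (0 : ℝ) e',
      (∀ k, Wf x k = 1 - ∑ p ∈ range k, ∑' j, G (fun i => solution B x (p + 1 + i)) j * ((solution B x (p + 1 + j)) ^ 3 / 2) * Wf x (p + 1 + j)) ∧
      ∀ k, |Wf x k| ≤ 2)
    (hWinff : ∀ x ∈ Ioc (0 : ℝ) e', Tendsto (Wf x) atTop (𝓝 (Winff x)))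
    {e : ℝ} (he : e ∈ Ioo (0 : ℝ) e')
    (hV : ∀ k, V k = (-∑ p ∈ range k, ∑' j,
        ((-∑' i, H (fun l => solution B e (p + 1 + l)) j i * ((solution B e (p + 1 + i)) ^ 3 / 2 * Wf e (p + 1 + i))) * ((solution B e (p + 1 + j)) ^ 3 / 2)
          + G (fun i => solution B e (p + 1 + i)) j * (-(3 / 4 * (solution B e (p + 1 + j)) ^ 5 * Wf e (p + 1 + j)))) * Wf e (p + 1 + j))
      - ∑ p ∈ range k, ∑' j, G (fun i => solution B e (p + 1 + i)) j * ((solution B e (p + 1 + j)) ^ 3 / 2) * V (p + 1 + j))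
    (hVM : ∀ k, |V k| ≤ MV) (hVinf : Tendsto V atTop (𝓝 Vinf)) :
    HasDerivAt Winff (Vinf * (-2 / e ^ 3)) e := by
  rw [hasDerivAt_iff_tendsto_slope, slope_fun_def_field]
  have hD := tangentLimitField_slope_tendsto hB hCm hθ0 hθ1 hbs hta hts htf hprof hG hGB hCH hH hHB h2e' hs1 hs2 hs4 hs5 hWf hWinff he hV hVM hVinf
  have hslope := hasDerivAt_iff_tendsto_slope.1 (chart_hasDerivAt he.1.ne')
  rw [slope_fun_def_field] at hslope
  have hprod := hD.mul hslope
  refine hprod.congr' ?_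
  have hmem : ∀ᶠ x in 𝓝 e, x ∈ Ioo (0 : ℝ) e' := Ioo_mem_nhds he.1 he.2
  filter_upwards [self_mem_nhdsWithin, eventually_nhdsWithin_of_eventually_nhds hmem] with x hne hx
  have hδne : 1 / x ^ 2 - 1 / e ^ 2 ≠ 0 := invSq_sub_ne_zero he.1 hx.1 hne
  rw [div_mul_div_comm, mul_comm (1 / x ^ 2 - 1 / e ^ 2), ← div_mul_div_comm, div_self hδne, mul_one]

/-! ## §148 Every dynamical Abel function is twice differentiable at every coupling -/

/-- The chart slope `x ↦ −2∕x³` has derivative `6∕e⁴` at `e ≠ 0`. [folklore] -/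
theorem chartFactor_hasDerivAt {e : ℝ} (he : e ≠ 0) : HasDerivAt (fun x : ℝ => -2 / x ^ 3) (6 / e ^ 4) e := by
  have h1 : HasDerivAt (fun x : ℝ => x ^ 3) (3 * e ^ 2) e := by simpa using hasDerivAt_pow 3 e
  have h2 := (h1.fun_inv (pow_ne_zero 3 he)).const_mul (-2)
  have e3 : -2 * (-(3 * e ^ 2) / (e ^ 3) ^ 2) = 6 / e ^ 4 := by
    field_simp
    ring
  rw [← e3]
  refine h2.congr_of_eventuallyEq (Eventually.of_forall fun x => ?_)
  simp [div_eq_mul_inv]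

/-- **THE DERIVATIVE OF Λ IS READ THROUGH THE LIMIT FIELD ON THE WHOLE OPEN BOX**: for a tangent field Wf with ultraviolet limits `Winff` and every dynamical Abel function Λ of the
flow (part 44's interface, C¹ letters): `deriv Λ x = Winff x·(−2∕x³)` at every `x ∈ ]0, e′[` (part 70's `deriv_dynAbel_eq`, pointwise).
[cite: Balaban1987RG1, Thm 2 (0.31) p.259 with (0.20) p.256 and p.298] -/
theorem deriv_dynAbel_eq_field {B : (ℕ → ℝ) → ℝ} {G : (ℕ → ℝ) → ℕ → ℝ} {Cm θ γ bs ta gs e' : ℝ} {t : ℕ → ℝ} {a : ℕ → ℝ} {Λ : ℝ → ℝ}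
    {Wf : ℝ → ℕ → ℝ} {Winff : ℝ → ℝ}
    (hB : MemoryProfile Cm θ γ B) (hCm : 0 ≤ Cm) (hθ0 : 0 ≤ θ) (hθ1 : θ < 1) (hbs : 0 < bs) (hta : 0 < ta)
    (hts : SeqBox γ t) (htf : MemFlow B gs t) (hprof : ∀ m : ℕ, 1 / ta ^ 2 + bs * (m : ℝ) ≤ 1 / (t m) ^ 2)
    (hG : ∀ u : ℕ → ℝ, SeqBox γ u → ∀ j, |G u j| ≤ Cm * θ ^ j)
    (hGB : ∀ ε > 0, ∃ ρ > 0, ∀ u u' : ℕ → ℝ, SeqBox γ u → SeqBox γ u' → (∀ j, |u' j - u j| ≤ ρ) →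
      |B u' - B u - ∑' j, G u j * (u' j - u j)| ≤ ε * ∑' j, θ ^ j * |u' j - u j|)
    (hΛ : ∀ e ∈ Ioc (0 : ℝ) e', ∀ h : ℕ → ℝ, SeqBox γ h → MemFlow B e h → Tendsto (fun n => 1 / h n ^ 2 - a n) atTop (𝓝 (Λ e)))
    (h2e' : 2 * e' ≤ γ) (hs1 : 4 * Cm * e' ≤ bs * (1 - θ))
    (hs2 : e' ^ 2 * (1 / gs ^ 2 + Cm * γ / (1 - θ) ^ 2 + (2 * Cm / ((1 - θ) * bs)) ^ 2) ≤ 3 / 4)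
    (hs4 : 64 * Cm * e' ^ 3 ≤ (1 - θ) ^ 2) (hs5 : Cm * (8 * e' ^ 3 + 16 * e' / bs) ≤ (1 - θ) / 4)
    (hWf : ∀ x ∈ Ioc (0 : ℝ) e',
      (∀ k, Wf x k = 1 - ∑ p ∈ range k, ∑' j, G (fun i => solution B x (p + 1 + i)) j * ((solution B x (p + 1 + j)) ^ 3 / 2) * Wf x (p + 1 + j)) ∧
      ∀ k, |Wf x k| ≤ 2)
    (hWinff : ∀ x ∈ Ioc (0 : ℝ) e', Tendsto (Wf x) atTop (𝓝 (Winff x))) :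
    ∀ x ∈ Ioo (0 : ℝ) e', deriv Λ x = Winff x * (-2 / x ^ 3) := fun x hx =>
  (deriv_dynAbel_eq hB hCm hθ0 hθ1 hbs hta hts htf hprof hG hGB hΛ h2e' hs1 hs2 hs4 hs5 hx (hWf x ⟨hx.1, hx.2.le⟩).1 (hWf x ⟨hx.1, hx.2.le⟩).2
    (hWinff x ⟨hx.1, hx.2.le⟩)).1

/-- **EVERY DYNAMICAL ABEL FUNCTION IS TWICE DIFFERENTIABLE AT EVERY INTERIOR COUPLING.**  Part 14's package at e′; the C² shape; Λ ANY dynamical Abel function (part 44's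
interface); a tangent field Wf with ultraviolet limits Winff (parts 70, 76); an interior pin e; V a bounded solution of part 78's derived equation at e (for `W = Wf e`) with
ultraviolet limit `V_∞`.  THEN **`HasDerivAt (deriv Λ) (V_∞·(−2∕e³)·(−2∕e³) + Winff e·(6∕e⁴)) e`** — the product rule on `Λ′(x) = Winff x·(−2∕x³)` (§147 + the chart slope).
[cite: Balaban1987RG1, Thm 2 (0.31) p.259 with (0.20) p.256 and p.298] -/
theorem hasDerivAt_deriv_dynAbel {B : (ℕ → ℝ) → ℝ} {G : (ℕ → ℝ) → ℕ → ℝ} {H : (ℕ → ℝ) → ℕ → ℕ → ℝ} {Cm CH θ γ bs ta gs e' MV Vinf : ℝ} {t V : ℕ → ℝ}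
    {a : ℕ → ℝ} {Λ : ℝ → ℝ} {Wf : ℝ → ℕ → ℝ} {Winff : ℝ → ℝ}
    (hB : MemoryProfile Cm θ γ B) (hCm : 0 ≤ Cm) (hθ0 : 0 ≤ θ) (hθ1 : θ < 1) (hbs : 0 < bs) (hta : 0 < ta)
    (hts : SeqBox γ t) (htf : MemFlow B gs t) (hprof : ∀ m : ℕ, 1 / ta ^ 2 + bs * (m : ℝ) ≤ 1 / (t m) ^ 2)
    (hG : ∀ u : ℕ → ℝ, SeqBox γ u → ∀ j, |G u j| ≤ Cm * θ ^ j)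
    (hGB : ∀ ε > 0, ∃ ρ > 0, ∀ u u' : ℕ → ℝ, SeqBox γ u → SeqBox γ u' → (∀ j, |u' j - u j| ≤ ρ) →
      |B u' - B u - ∑' j, G u j * (u' j - u j)| ≤ ε * ∑' j, θ ^ j * |u' j - u j|) (hCH : 0 ≤ CH)
    (hH : ∀ u : ℕ → ℝ, SeqBox γ u → ∀ j i, |H u j i| ≤ CH * θ ^ j * θ ^ i)
    (hHB : ∀ ε > 0, ∃ ρ > 0, ∀ u u' : ℕ → ℝ, SeqBox γ u → SeqBox γ u' → (∀ j, |u' j - u j| ≤ ρ) →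
      ∀ j, |G u' j - G u j - ∑' i, H u j i * (u' i - u i)| ≤ ε * θ ^ j * ∑' i, θ ^ i * |u' i - u i|)
    (hΛ : ∀ e ∈ Ioc (0 : ℝ) e', ∀ h : ℕ → ℝ, SeqBox γ h → MemFlow B e h → Tendsto (fun n => 1 / h n ^ 2 - a n) atTop (𝓝 (Λ e)))
    (h2e' : 2 * e' ≤ γ) (hs1 : 4 * Cm * e' ≤ bs * (1 - θ))
    (hs2 : e' ^ 2 * (1 / gs ^ 2 + Cm * γ / (1 - θ) ^ 2 + (2 * Cm / ((1 - θ) * bs)) ^ 2) ≤ 3 / 4)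
    (hs4 : 64 * Cm * e' ^ 3 ≤ (1 - θ) ^ 2) (hs5 : Cm * (8 * e' ^ 3 + 16 * e' / bs) ≤ (1 - θ) / 4)
    (hWf : ∀ x ∈ Ioc (0 : ℝ) e',
      (∀ k, Wf x k = 1 - ∑ p ∈ range k, ∑' j, G (fun i => solution B x (p + 1 + i)) j * ((solution B x (p + 1 + j)) ^ 3 / 2) * Wf x (p + 1 + j)) ∧
      ∀ k, |Wf x k| ≤ 2)
    (hWinff : ∀ x ∈ Ioc (0 : ℝ) e', Tendsto (Wf x) atTop (𝓝 (Winff x)))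
    {e : ℝ} (he : e ∈ Ioo (0 : ℝ) e')
    (hV : ∀ k, V k = (-∑ p ∈ range k, ∑' j,
        ((-∑' i, H (fun l => solution B e (p + 1 + l)) j i * ((solution B e (p + 1 + i)) ^ 3 / 2 * Wf e (p + 1 + i))) * ((solution B e (p + 1 + j)) ^ 3 / 2)
          + G (fun i => solution B e (p + 1 + i)) j * (-(3 / 4 * (solution B e (p + 1 + j)) ^ 5 * Wf e (p + 1 + j)))) * Wf e (p + 1 + j))
      - ∑ p ∈ range k, ∑' j, G (fun i => solution B e (p + 1 + i)) j * ((solution B e (p + 1 + j)) ^ 3 / 2) * V (p + 1 + j))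
    (hVM : ∀ k, |V k| ≤ MV) (hVinf : Tendsto V atTop (𝓝 Vinf)) :
    HasDerivAt (deriv Λ) (Vinf * (-2 / e ^ 3) * (-2 / e ^ 3) + Winff e * (6 / e ^ 4)) e := by
  have hW := hasDerivAt_tangentLimitField hB hCm hθ0 hθ1 hbs hta hts htf hprof hG hGB hCH hH hHB h2e' hs1 hs2 hs4 hs5 hWf hWinff he hV hVM hVinf
  have hF := hW.mul (chartFactor_hasDerivAt he.1.ne')
  refine hF.congr_of_eventuallyEq ?_
  have hmem : ∀ᶠ x in 𝓝 e, x ∈ Ioo (0 : ℝ) e' := Ioo_mem_nhds he.1 he.2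
  filter_upwards [hmem] with x hx
  exact deriv_dynAbel_eq_field hB hCm hθ0 hθ1 hbs hta hts htf hprof hG hGB hΛ h2e' hs1 hs2 hs4 hs5 hWf hWinff x hx

/-- **THE SECOND DERIVATIVE IN CLOSED FORM**: under the hypotheses of `hasDerivAt_deriv_dynAbel`,
**`Λ″(e) = 4V_∞∕e⁶ + 6W_∞(e)∕e⁴ = −(3∕e)·Λ′(e) + (4∕e⁶)·V_∞`** (`W_∞(e) = (−e³∕2)Λ′(e)`, part 70) — the one-loop part `−(3∕e)Λ′` (exact for `Λ = 1∕e²`) plus the memory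
correction carried by the second tangent flow. [cite: Balaban1987RG1, Thm 2 (0.31) p.259 with (0.20) p.256 and p.298] -/
theorem deriv_deriv_dynAbel_eq {B : (ℕ → ℝ) → ℝ} {G : (ℕ → ℝ) → ℕ → ℝ} {H : (ℕ → ℝ) → ℕ → ℕ → ℝ} {Cm CH θ γ bs ta gs e' MV Vinf : ℝ} {t V : ℕ → ℝ}
    {a : ℕ → ℝ} {Λ : ℝ → ℝ} {Wf : ℝ → ℕ → ℝ} {Winff : ℝ → ℝ}
    (hB : MemoryProfile Cm θ γ B) (hCm : 0 ≤ Cm) (hθ0 : 0 ≤ θ) (hθ1 : θ < 1) (hbs : 0 < bs) (hta : 0 < ta)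
    (hts : SeqBox γ t) (htf : MemFlow B gs t) (hprof : ∀ m : ℕ, 1 / ta ^ 2 + bs * (m : ℝ) ≤ 1 / (t m) ^ 2)
    (hG : ∀ u : ℕ → ℝ, SeqBox γ u → ∀ j, |G u j| ≤ Cm * θ ^ j)
    (hGB : ∀ ε > 0, ∃ ρ > 0, ∀ u u' : ℕ → ℝ, SeqBox γ u → SeqBox γ u' → (∀ j, |u' j - u j| ≤ ρ) →
      |B u' - B u - ∑' j, G u j * (u' j - u j)| ≤ ε * ∑' j, θ ^ j * |u' j - u j|) (hCH : 0 ≤ CH)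
    (hH : ∀ u : ℕ → ℝ, SeqBox γ u → ∀ j i, |H u j i| ≤ CH * θ ^ j * θ ^ i)
    (hHB : ∀ ε > 0, ∃ ρ > 0, ∀ u u' : ℕ → ℝ, SeqBox γ u → SeqBox γ u' → (∀ j, |u' j - u j| ≤ ρ) →
      ∀ j, |G u' j - G u j - ∑' i, H u j i * (u' i - u i)| ≤ ε * θ ^ j * ∑' i, θ ^ i * |u' i - u i|)
    (hΛ : ∀ e ∈ Ioc (0 : ℝ) e', ∀ h : ℕ → ℝ, SeqBox γ h → MemFlow B e h → Tendsto (fun n => 1 / h n ^ 2 - a n) atTop (𝓝 (Λ e)))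
    (h2e' : 2 * e' ≤ γ) (hs1 : 4 * Cm * e' ≤ bs * (1 - θ))
    (hs2 : e' ^ 2 * (1 / gs ^ 2 + Cm * γ / (1 - θ) ^ 2 + (2 * Cm / ((1 - θ) * bs)) ^ 2) ≤ 3 / 4)
    (hs4 : 64 * Cm * e' ^ 3 ≤ (1 - θ) ^ 2) (hs5 : Cm * (8 * e' ^ 3 + 16 * e' / bs) ≤ (1 - θ) / 4)
    (hWf : ∀ x ∈ Ioc (0 : ℝ) e',
      (∀ k, Wf x k = 1 - ∑ p ∈ range k, ∑' j, G (fun i => solution B x (p + 1 + i)) j * ((solution B x (p + 1 + j)) ^ 3 / 2) * Wf x (p + 1 + j)) ∧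
      ∀ k, |Wf x k| ≤ 2)
    (hWinff : ∀ x ∈ Ioc (0 : ℝ) e', Tendsto (Wf x) atTop (𝓝 (Winff x)))
    {e : ℝ} (he : e ∈ Ioo (0 : ℝ) e')
    (hV : ∀ k, V k = (-∑ p ∈ range k, ∑' j,
        ((-∑' i, H (fun l => solution B e (p + 1 + l)) j i * ((solution B e (p + 1 + i)) ^ 3 / 2 * Wf e (p + 1 + i))) * ((solution B e (p + 1 + j)) ^ 3 / 2)
          + G (fun i => solution B e (p + 1 + i)) j * (-(3 / 4 * (solution B e (p + 1 + j)) ^ 5 * Wf e (p + 1 + j)))) * Wf e (p + 1 + j))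
      - ∑ p ∈ range k, ∑' j, G (fun i => solution B e (p + 1 + i)) j * ((solution B e (p + 1 + j)) ^ 3 / 2) * V (p + 1 + j))
    (hVM : ∀ k, |V k| ≤ MV) (hVinf : Tendsto V atTop (𝓝 Vinf)) :
    deriv (deriv Λ) e = 4 * Vinf / e ^ 6 + 6 * Winff e / e ^ 4 ∧ deriv (deriv Λ) e = -(3 / e) * deriv Λ e + 4 / e ^ 6 * Vinf := by
  have h := (hasDerivAt_deriv_dynAbel hB hCm hθ0 hθ1 hbs hta hts htf hprof hG hGB hCH hH hHB hΛ h2e' hs1 hs2 hs4 hs5 hWf hWinff he hV hVM hVinf).deriv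
  have h1 := deriv_dynAbel_eq_field hB hCm hθ0 hθ1 hbs hta hts htf hprof hG hGB hΛ h2e' hs1 hs2 hs4 hs5 hWf hWinff e he
  have he0 : e ≠ 0 := he.1.ne'
  constructor
  · rw [h]; field_simp; ring
  · rw [h, h1]; field_simp; ring

/-- **`Λ′` IS DIFFERENTIABLE ON THE WHOLE OPEN BOX ]0, e′[** for every dynamical Abel function of a flow with a C² memory functional — all witnesses produced: the tangent field
(part 76), its ultraviolet limits (part 70), the second tangent flow and its limit (part 78) at every interior pin.  With part 71: Λ ∈ C¹ and Λ′ differentiable everywhere; the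
continuity of Λ″ is the next module's business. [cite: Balaban1987RG1, Thm 2 (0.31) p.259 with (0.20) p.256 and p.298] -/
theorem differentiableOn_deriv_dynAbel {B : (ℕ → ℝ) → ℝ} {G : (ℕ → ℝ) → ℕ → ℝ} {H : (ℕ → ℝ) → ℕ → ℕ → ℝ} {Cm CH θ γ bs ta gs e' : ℝ} {t : ℕ → ℝ}
    {a : ℕ → ℝ} {Λ : ℝ → ℝ}
    (hB : MemoryProfile Cm θ γ B) (hCm : 0 ≤ Cm) (hθ0 : 0 ≤ θ) (hθ1 : θ < 1) (hbs : 0 < bs) (hta : 0 < ta)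
    (hts : SeqBox γ t) (htf : MemFlow B gs t) (hprof : ∀ m : ℕ, 1 / ta ^ 2 + bs * (m : ℝ) ≤ 1 / (t m) ^ 2)
    (hG : ∀ u : ℕ → ℝ, SeqBox γ u → ∀ j, |G u j| ≤ Cm * θ ^ j)
    (hGB : ∀ ε > 0, ∃ ρ > 0, ∀ u u' : ℕ → ℝ, SeqBox γ u → SeqBox γ u' → (∀ j, |u' j - u j| ≤ ρ) →
      |B u' - B u - ∑' j, G u j * (u' j - u j)| ≤ ε * ∑' j, θ ^ j * |u' j - u j|) (hCH : 0 ≤ CH)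
    (hH : ∀ u : ℕ → ℝ, SeqBox γ u → ∀ j i, |H u j i| ≤ CH * θ ^ j * θ ^ i)
    (hHB : ∀ ε > 0, ∃ ρ > 0, ∀ u u' : ℕ → ℝ, SeqBox γ u → SeqBox γ u' → (∀ j, |u' j - u j| ≤ ρ) →
      ∀ j, |G u' j - G u j - ∑' i, H u j i * (u' i - u i)| ≤ ε * θ ^ j * ∑' i, θ ^ i * |u' i - u i|)
    (hΛ : ∀ e ∈ Ioc (0 : ℝ) e', ∀ h : ℕ → ℝ, SeqBox γ h → MemFlow B e h → Tendsto (fun n => 1 / h n ^ 2 - a n) atTop (𝓝 (Λ e)))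
    (h2e' : 2 * e' ≤ γ) (hs1 : 4 * Cm * e' ≤ bs * (1 - θ))
    (hs2 : e' ^ 2 * (1 / gs ^ 2 + Cm * γ / (1 - θ) ^ 2 + (2 * Cm / ((1 - θ) * bs)) ^ 2) ≤ 3 / 4)
    (hs4 : 64 * Cm * e' ^ 3 ≤ (1 - θ) ^ 2) (hs5 : Cm * (8 * e' ^ 3 + 16 * e' / bs) ≤ (1 - θ) / 4) :
    DifferentiableOn ℝ (deriv Λ) (Ioo 0 e') ∧
      ∀ e ∈ Ioo (0 : ℝ) e', ∃ Winf Vinf : ℝ, HasDerivAt (deriv Λ) (Vinf * (-2 / e ^ 3) * (-2 / e ^ 3) + Winf * (6 / e ^ 4)) e ∧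
        deriv Λ e = Winf * (-2 / e ^ 3) ∧ deriv (deriv Λ) e = -(3 / e) * deriv Λ e + 4 / e ^ 6 * Vinf := by
  -- the tangent field and its ultraviolet limits
  obtain ⟨Wf, hWf⟩ := tangentField_exists hB hCm hθ0 hθ1 hbs hta hts htf hprof hG h2e' hs1 hs2 hs4 hs5
  have hlim : ∀ x ∈ Ioc (0 : ℝ) e', ∃ L : ℝ, Tendsto (Wf x) atTop (𝓝 L) := fun x hx => by
    obtain ⟨L, hL, -⟩ := tangentLimit_exists hB hCm hθ0 hθ1 hbs hta hts htf hprof hG h2e' hs1 hs2 hs4 hs5 hx (hWf x hx).1 (hWf x hx).2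
    exact ⟨L, hL⟩
  classical
  set Winff : ℝ → ℝ := fun x => if hx : x ∈ Ioc (0 : ℝ) e' then Classical.choose (hlim x hx) else 0 with hWinffdef
  have hWinff : ∀ x ∈ Ioc (0 : ℝ) e', Tendsto (Wf x) atTop (𝓝 (Winff x)) := fun x hx => by
    simp only [hWinffdef, dif_pos hx]
    exact Classical.choose_spec (hlim x hx)
  have key : ∀ e ∈ Ioo (0 : ℝ) e', ∃ Vinf : ℝ, HasDerivAt (deriv Λ) (Vinf * (-2 / e ^ 3) * (-2 / e ^ 3) + Winff e * (6 / e ^ 4)) e ∧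
      deriv Λ e = Winff e * (-2 / e ^ 3) ∧ deriv (deriv Λ) e = -(3 / e) * deriv Λ e + 4 / e ^ 6 * Vinf := by
    intro e he
    have hec : e ∈ Ioc (0 : ℝ) e' := ⟨he.1, he.2.le⟩
    obtain ⟨hW, hWM⟩ := hWf e hec
    -- the derived source and the second tangent flow at e
    obtain ⟨σ, hσ⟩ : ∃ σ : ℕ → ℝ, ∀ k, σ k = -∑ p ∈ range k, ∑' j,
        ((-∑' i, H (fun l => solution B e (p + 1 + l)) j i * ((solution B e (p + 1 + i)) ^ 3 / 2 * Wf e (p + 1 + i))) * ((solution B e (p + 1 + j)) ^ 3 / 2)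
          + G (fun i => solution B e (p + 1 + i)) j * (-(3 / 4 * (solution B e (p + 1 + j)) ^ 5 * Wf e (p + 1 + j)))) * Wf e (p + 1 + j) := ⟨_, fun k => rfl⟩
    obtain ⟨V, hV, hVM⟩ := secondTangent_exists hB hCm hθ0 hθ1 hbs hta hts htf hprof hG hCH hH h2e' hs1 hs2 hs4 hs5 hec hW hWM hσ
    obtain ⟨σinf, hσinf, -⟩ := derivedSource_limit_exists hB hCm hθ0 hθ1 hbs hta hts htf hprof hG hCH hH h2e' hs1 hs2 hs4 hs5 hec hW hWM hσ
    obtain ⟨Vinf, hVinf, -⟩ := secondTangentLimit_exists hB hCm hθ0 hθ1 hbs hta hts htf hprof hG h2e' hs1 hs2 hs4 hs5 hec hV hVM hσinf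
    have hV' : ∀ k, V k = (-∑ p ∈ range k, ∑' j,
        ((-∑' i, H (fun l => solution B e (p + 1 + l)) j i * ((solution B e (p + 1 + i)) ^ 3 / 2 * Wf e (p + 1 + i))) * ((solution B e (p + 1 + j)) ^ 3 / 2)
          + G (fun i => solution B e (p + 1 + i)) j * (-(3 / 4 * (solution B e (p + 1 + j)) ^ 5 * Wf e (p + 1 + j)))) * Wf e (p + 1 + j))
        - ∑ p ∈ range k, ∑' j, G (fun i => solution B e (p + 1 + i)) j * ((solution B e (p + 1 + j)) ^ 3 / 2) * V (p + 1 + j) := fun k => by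
      rw [hV k, hσ k]
    refine ⟨Vinf, hasDerivAt_deriv_dynAbel hB hCm hθ0 hθ1 hbs hta hts htf hprof hG hGB hCH hH hHB hΛ h2e' hs1 hs2 hs4 hs5 hWf hWinff he hV' hVM hVinf,
      deriv_dynAbel_eq_field hB hCm hθ0 hθ1 hbs hta hts htf hprof hG hGB hΛ h2e' hs1 hs2 hs4 hs5 hWf hWinff e he,
      (deriv_deriv_dynAbel_eq hB hCm hθ0 hθ1 hbs hta hts htf hprof hG hGB hCH hH hHB hΛ h2e' hs1 hs2 hs4 hs5 hWf hWinff he hV' hVM hVinf).2⟩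
  refine ⟨fun e he => ?_, fun e he => ⟨Winff e, key e he⟩⟩
  obtain ⟨Vinf, hd, -, -⟩ := key e he
  exact hd.differentiableAt.differentiableWithinAt

end

end Summit.QuantumFields.BalabanUV.Beta.EriceFlowEnclosureB12AsPrintedHistoryContagionShiftFlowZeroTangentSecondDeriv
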